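import Summits.CriticalPhenomena.SAWScalingLimit.Theses.SAWDefectDecoherence
import Summits.CriticalPhenomena.SAWScalingLimit.Theorems.SAWDevelopingMapHexConjectureAvoidanceCocycleRootPhase
import Summits.CriticalPhenomena.SAWScalingLimit.Theorems.SAWDevelopingMapHexConjectureAvoidanceCocyclePackage
import Summits.CriticalPhenomena.SAWScalingLimit.Theorems.SAWDevelopingMapHexConjectureAvoidanceCocycleIntegral
import Summits.CriticalPhenomena.SAWScalingLimit.Theorems.SAWDefectDecoherenceBoundaryClosureRLocalL1Normaliser
import HarnessLib

/-!
# Crux `HexConjecture` (stmt-CriticalPhenomena-0808), line `root-locality-replaces-loewner`,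
stub `stub_avoidanceCocycle`, steps (a)+(b): the restriction cocycle from the observable limit and
root dominance

Landing target:
`Summits/CriticalPhenomena/SAWScalingLimit/Theorems/SAWDevelopingMapHexConjectureAvoidanceCocycleAssembly.lean`
(`--supports stmt-CriticalPhenomena-0808`).

`restrictionLimit_of_rootDominance` (registered as `stub_avoidanceCocycle_restrictionLimit`):
`HexObservableLimitR → RootDominance → AdmissibleRestrictionLimit♭` — in the flat-boundary class (a
Dobrushin domain flat at both marked points, NOT necessarily above a floor line), for nested
admissible vertex-domain families `Λ' δ ⊆ Λ δ` discretising a hull subdomain `D' ⊆ D` with common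
boundary root/target mid-edges, the exact lattice restriction probability
`Z_{Λ'δ}(a δ, b δ)/Z_{Λδ}(a δ, b δ)` tends to the Lawler–Schramm–Werner value `Φ_A'(0)^{5/8}`.
Ingredients: (a) winding rigidity at the boundary target (`|F(b δ)| = Z`,
`norm_observable_eq_mass_of_mem_boundary`); (b) two instances of the observable limit on the
root-dominance bumps, the angular localisation at the root (`…CocycleRootPhase`), the conformal
package with the root datum `|q₀| = d^{-5/8}` (`…CocyclePackage`) and the bounds for the two limit
functionals (`…CocycleIntegral`).
-/

noncomputable section

open scoped Topology Real NNReal ENNReal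
open Filter Set Metric Complex MeasureTheory
open Literature.Probability.RandomPlanarGeometry
open UpperHalfPlane (upperHalfPlaneSet isOpen_upperHalfPlaneSet)

namespace Summit.CriticalPhenomena.SAWScalingLimit.Theorems.HexConjecture.RootLocality.Cocycle

section Assembly

open Literature.Probability.LatticeModels (HexVertex hexGraph hexCenter)
open Literature.Probability.RandomPlanarGeometry.SAW
open Summit.CriticalPhenomena.SAWScalingLimit.Theorems.PickHalfPlane.LocalL1
  (norm_observable_eq_mass_of_mem_boundary observable_ne_zero_of_mem_boundary)

/-! ### A norm identity -/

/-- **Registered helper `stub_avoidanceCocycle_normIdentity`** (crux item stmt-CriticalPhenomena-0808,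
line `root-locality-replaces-loewner`, stub `stub_avoidanceCocycle`): if the normalised functional is
`T = δ² S / F` with `F, T ≠ 0`, then `|F| = δ² |S| / |T|` (used to rewrite the boundary values
`F(b δ)` of the two observables through the two observable limits). [folklore] -/
theorem stub_avoidanceCocycle_normIdentity : ∀ (T S F : ℂ) (δ : ℝ), 0 ≤ δ → F ≠ 0 → T ≠ 0 → T = (δ : ℂ) ^ 2 * S / F → ‖F‖ = δ ^ 2 * ‖S‖ / ‖T‖ := by
  intro T S F δ hδ hF hT h
  have h1 : T * F = (δ : ℂ) ^ 2 * S := by rw [h, div_mul_cancel₀ _ hF]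
  have h2 := congrArg norm h1
  rw [norm_mul, norm_mul, norm_pow, Complex.norm_real, Real.norm_of_nonneg hδ] at h2
  rw [eq_div_iff (norm_ne_zero_iff.2 hT), mul_comm]
  exact h2

/-! ### The restriction cocycle from the observable limit and root dominance -/

/-- **The admissible restriction cocycle of the critical hexagonal SAW in the flat-boundary class,
from Duminil-Copin–Smirnov's Conjecture 2 (`HexObservableLimitR`, stmt-CriticalPhenomena-14003)
and ROOT DOMINANCE.**  For a Dobrushin domain `(D; a, b)` flat at both marked points, a hull
subdomain `D'` with restriction data `(φ, Φ_A, d = Φ_A'(0))`, and nested admissible families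
`Λ' δ ⊆ Λ δ` discretising `D' ⊆ D` (hex-simply-connected, connected, exact half-lattice rows in
the two balls, exhausting the compacts) with common boundary root and target mid-edges
`a δ → a`, `b δ → b`, the exact lattice restriction probability
`Z_{Λ' δ}(a δ, b δ) / Z_{Λ δ}(a δ, b δ)` tends to the Lawler–Schramm–Werner value `d^{5/8}`.
Proof: `Z = |F(b δ)|` by winding rigidity at the boundary target; the observable limit in
`(D, Λ)` and `(D', Λ')` on the root-dominance bumps `ψ_r` gives
`Z'/Z = (|S'|/|S|) · (|T|/|T'|)` with `|S'|/|S| ∈ [1 - η, 1 + η]` and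
`|T|/|T'| → |I_Ω(ψ_r)| / |I_{Ω'}(ψ_r)|`, which lies within `O(η)` of `d^{5/8}` by the angular
localisation at the root and the coalescence `|q₀| = d^{-5/8}` of the two kernels.
[cite: LawlerSchrammWerner2004SAW, §3.4 ("SAW satisfies restriction") and Prop. 2] -/
theorem restrictionLimit_of_rootDominance
    (hO : ∃ c : ℂ, c ≠ 0 ∧ ∀ (D : Literature.Probability.RandomPlanarGeometry.DobrushinDomain) (ρ : ℝ) (Λ : ℝ → Finset Literature.Probability.LatticeModels.HexVertex) (m : Fin 2 → ℝ → ℤ) (a b : ℝ → Sym2 Literature.Probability.LatticeModels.HexVertex) (Φ : Literature.Probability.RandomPlanarGeometry.ConformalEquiv D.carrier UpperHalfPlane.upperHalfPlaneSet) (L : ℂ → ℂ) (Lb : ℂ) (ψ : ℂ → ℂ), let F : ℝ → Sym2 Literature.Probability.LatticeModels.HexVertex → ℂ := fun δ z => Literature.Probability.RandomPlanarGeometry.SAW.hexParafermionicObservable (Λ δ) (a δ) Literature.Probability.RandomPlanarGeometry.SAW.hexCriticalFugacity (5 / 8) z; 0 < ρ → (∀ i : Fin 2, D.carrier ∩ Metric.ball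 (D.pt i) ρ = {z : ℂ | (D.pt i).im < z.im} ∩ Metric.ball (D.pt i) ρ) → (∀ᶠ δ : ℝ in nhdsWithin 0 (Set.Ioi 0), Literature.Probability.RandomPlanarGeometry.SAW.hexDomainSimplyConnected (Λ δ) ∧ a δ ∈ Literature.Probability.RandomPlanarGeometry.SAW.hexDomainBoundary (Λ δ) ∧ b δ ∈ Literature.Probability.RandomPlanarGeometry.SAW.hexDomainBoundary (Λ δ) ∧ Nonempty (Literature.Probability.RandomPlanarGeometry.SAW.HexMidEdgeSAW (Λ δ) (a δ) (b δ)) ∧ (Literature.Probability.LatticeModels.hexGraph.induce ((Λ δ : Finset Literature.Probability.LatticeModels.HexVertex) : Set Literature.Probability.LatticeModels.HexVertex)).Preconnected ∧ (∀ v ∈ Λ δ, (δ : ℂ) * Literature.Probability.LatticeModels.hexCenter v ∈ D.carrier) ∧ (∀ i : Fin 2, ∀ v : Literature.Probability.LatticeModels.HexVertex, (δ : ℂ) * Literature.Probability.LatticeModels.hexCenter v ∈ Metric.ball (D.pt i) ρ → (v ∈ Λ δ ↔ m i δ ≤ v.1 1))) → (∀ K : Set ℂ, IsCompact K → K ⊆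 D.carrier → ∀ᶠ δ : ℝ in nhdsWithin 0 (Set.Ioi 0), ∀ v : Literature.Probability.LatticeModels.HexVertex, (δ : ℂ) * Literature.Probability.LatticeModels.hexCenter v ∈ K → v ∈ Λ δ) → Filter.Tendsto (fun δ : ℝ => (δ : ℂ) * Literature.Probability.RandomPlanarGeometry.SAW.hexMidpoint (a δ)) (nhdsWithin 0 (Set.Ioi 0)) (nhds (D.pt 0)) → Filter.Tendsto (fun δ : ℝ => (δ : ℂ) * Literature.Probability.RandomPlanarGeometry.SAW.hexMidpoint (b δ)) (nhdsWithin 0 (Set.Ioi 0)) (nhds (D.pt 1)) → Filter.Tendsto (fun x => ‖Φ x‖) (nhdsWithin (D.pt 0) D.carrier) Filter.atTop → Φ.HasBoundaryValue (D.pt 1) 0 → ContinuousOn L D.carrier → (∀ z ∈ D.carrier, Complex.exp (L z) = deriv Φ z) → Filter.Tendsto L (nhdsWithin (D.pt 1) D.carrier) (nhds Lb) → Continuous ψ → HasCompactSupport ψ → tsupport ψ ⊆ D.carrier → Filter.Tendsto (fun δ : ℝ => (δ : ℂ) ^ 2 * (∑ᶠ e ∈ Literature.Probability.RandomPlanarGeometry.SAW.hexDomainMidEdges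 (Λ δ), ψ ((δ : ℂ) * Literature.Probability.RandomPlanarGeometry.SAW.hexMidpoint e) * F δ e) / F δ (b δ)) (nhdsWithin 0 (Set.Ioi 0)) (nhds (c * ∫ z, ψ z * Complex.exp ((5 / 8 : ℂ) * (L z - Lb)))))
    (hRD : ∀ (D : Literature.Probability.RandomPlanarGeometry.DobrushinDomain) (ρ : ℝ) (Λ Λ' : ℝ → Finset Literature.Probability.LatticeModels.HexVertex) (m : ℝ → ℤ) (a : ℝ → Sym2 Literature.Probability.LatticeModels.HexVertex), 0 < ρ → D.carrier ∩ Metric.ball (D.pt 0) ρ = {z : ℂ | (D.pt 0).im < z.im} ∩ Metric.ball (D.pt 0) ρ → (∀ᶠ δ : ℝ in nhdsWithin (0 : ℝ) (Set.Ioi 0), Literature.Probability.RandomPlanarGeometry.SAW.hexDomainSimplyConnected (Λ δ) ∧ Literature.Probability.RandomPlanarGeometry.SAW.hexDomainSimplyConnected (Λ' δ) ∧ Λ' δ ⊆ Λ δ ∧ a δ ∈ Literature.Probability.RandomPlanarGeometry.SAW.hexDomainBoundary (Λ δ) ∧ a δ ∈ Literature.Probability.RandomPlanarGeometry.SAW.hexDomainBoundary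 (Λ' δ) ∧ (∀ v ∈ Λ δ, (δ : ℂ) * Literature.Probability.LatticeModels.hexCenter v ∈ D.carrier) ∧ (∀ v : Literature.Probability.LatticeModels.HexVertex, (δ : ℂ) * Literature.Probability.LatticeModels.hexCenter v ∈ Metric.ball (D.pt 0) ρ → (v ∈ Λ δ ↔ m δ ≤ v.1 1)) ∧ (∀ v : Literature.Probability.LatticeModels.HexVertex, (δ : ℂ) * Literature.Probability.LatticeModels.hexCenter v ∈ Metric.ball (D.pt 0) ρ → (v ∈ Λ' δ ↔ v ∈ Λ δ))) → Filter.Tendsto (fun δ : ℝ => (δ : ℂ) * Literature.Probability.RandomPlanarGeometry.SAW.hexMidpoint (a δ)) (nhdsWithin (0 : ℝ) (Set.Ioi 0)) (nhds (D.pt 0)) → ∀ ε : ℝ, 0 < ε → ∃ r₀ : ℝ, 0 < r₀ ∧ ∀ r : ℝ, 0 < r → r < r₀ → ∃ ψ : ℂ → ℝ, Continuous ψ ∧ HasCompactSupport ψ ∧ (∀ z, 0 ≤ ψ z) ∧ (∃ z, ψ z ≠ 0) ∧ tsupport ψ ⊆ Metric.ball (D.pt 0 + (r : ℂ) * Complex.I)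 (r / 4) ∧ ∀ᶠ δ : ℝ in nhdsWithin (0 : ℝ) (Set.Ioi 0), ‖(∑ᶠ e ∈ Literature.Probability.RandomPlanarGeometry.SAW.hexDomainMidEdges (Λ' δ), (ψ ((δ : ℂ) * Literature.Probability.RandomPlanarGeometry.SAW.hexMidpoint e) : ℂ) * Literature.Probability.RandomPlanarGeometry.SAW.hexParafermionicObservable (Λ' δ) (a δ) Literature.Probability.RandomPlanarGeometry.SAW.hexCriticalFugacity (5 / 8) e) - ∑ᶠ e ∈ Literature.Probability.RandomPlanarGeometry.SAW.hexDomainMidEdges (Λ δ), (ψ ((δ : ℂ) * Literature.Probability.RandomPlanarGeometry.SAW.hexMidpoint e) : ℂ) * Literature.Probability.RandomPlanarGeometry.SAW.hexParafermionicObservable (Λ δ) (a δ) Literature.Probability.RandomPlanarGeometry.SAW.hexCriticalFugacity (5 / 8) e‖ ≤ ε * ‖∑ᶠ e ∈ Literature.Probability.RandomPlanarGeometry.SAW.hexDomainMidEdges (Λ δ), (ψ ((δ : ℂ) * Literature.Probability.RandomPlanarGeometry.SAW.hexMidpoint e) : ℂ) * Literature.Probability.RandomPlanarGeometry.SAW.hexParafermionicObservable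 (Λ δ) (a δ) Literature.Probability.RandomPlanarGeometry.SAW.hexCriticalFugacity (5 / 8) e‖) :
    ∀ (D D' : DobrushinDomain) (ρ : ℝ) (φ : ConformalEquiv upperHalfPlaneSet D.carrier)
      (Φ : ConformalEquiv (upperHalfPlaneSet \ φ.pullbackHull D') upperHalfPlaneSet) (d : ℝ)
      (Λ Λ' : ℝ → Finset HexVertex) (m : Fin 2 → ℝ → ℤ) (a b : ℝ → Sym2 HexVertex),
      0 < ρ →
      (∀ i : Fin 2, D.carrier ∩ ball (D.pt i) ρ = {z : ℂ | (D.pt i).im < z.im} ∩ ball (D.pt i) ρ) →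
      D.IsHullSubdomain D' → D.IsChordalUniformizing φ →
      IsRestrictionMap (φ.pullbackHull D') Φ → HasRestrictionDeriv (φ.pullbackHull D') Φ d →
      (∀ᶠ δ : ℝ in 𝓝[>] 0,
        Λ' δ ⊆ Λ δ ∧ hexDomainSimplyConnected (Λ δ) ∧ hexDomainSimplyConnected (Λ' δ) ∧
        (hexGraph.induce (↑(Λ δ) : Set HexVertex)).Preconnected ∧
        (hexGraph.induce (↑(Λ' δ) : Set HexVertex)).Preconnected ∧
        a δ ∈ hexDomainBoundary (Λ δ) ∧ b δ ∈ hexDomainBoundary (Λ δ) ∧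
        a δ ∈ hexDomainBoundary (Λ' δ) ∧ b δ ∈ hexDomainBoundary (Λ' δ) ∧
        Nonempty (HexMidEdgeSAW (Λ' δ) (a δ) (b δ)) ∧
        (∀ v ∈ Λ δ, (δ : ℂ) * hexCenter v ∈ D.carrier) ∧
        (∀ v ∈ Λ' δ, (δ : ℂ) * hexCenter v ∈ D'.carrier) ∧
        (∀ i : Fin 2, ∀ v : HexVertex, (δ : ℂ) * hexCenter v ∈ ball (D.pt i) ρ →
          ((v ∈ Λ δ ↔ m i δ ≤ v.1 1) ∧ (v ∈ Λ' δ ↔ m i δ ≤ v.1 1)))) →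
      (∀ K : Set ℂ, IsCompact K → K ⊆ D.carrier →
        ∀ᶠ δ : ℝ in 𝓝[>] 0, ∀ v : HexVertex, (δ : ℂ) * hexCenter v ∈ K → v ∈ Λ δ) →
      (∀ K : Set ℂ, IsCompact K → K ⊆ D'.carrier →
        ∀ᶠ δ : ℝ in 𝓝[>] 0, ∀ v : HexVertex, (δ : ℂ) * hexCenter v ∈ K → v ∈ Λ' δ) →
      Tendsto (fun δ : ℝ => (δ : ℂ) * hexMidpoint (a δ)) (𝓝[>] 0) (𝓝 (D.pt 0)) →
      Tendsto (fun δ : ℝ => (δ : ℂ) * hexMidpoint (b δ)) (𝓝[>] 0) (𝓝 (D.pt 1)) →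
      Tendsto (fun δ : ℝ =>
        (∑ γ : HexMidEdgeSAW (Λ' δ) (a δ) (b δ), hexCriticalFugacity ^ γ.length) /
          (∑ γ : HexMidEdgeSAW (Λ δ) (a δ) (b δ), hexCriticalFugacity ^ γ.length))
        (𝓝[>] 0) (𝓝 (d ^ ((5 : ℝ) / 8))) := by
  intro D D' ρ φ Φ d Λ Λ' m a b hρ hflat hD' hφ hΦ hd hadm hK hK' ha hb
  obtain ⟨c, hc0, H⟩ := hO
  obtain ⟨Ψ, L, Lb, Ψ', L', L'b, ρ₁, q₀, hρ₁, hρ₁ρ, hd0, hΨf, hΨinf, hΨb, hLc, hLe, hLb, hΨ'inf,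
    hΨ'b, hL'c, hL'e, hL'b, hflat0', hflat1', hq₀, hqlim⟩ :=
    exists_conformalPackageRoot D D' ρ φ Φ d hρ (hflat 0) (hflat 1) hD' hφ hΦ hd
  obtain ⟨r₁, hr₁, hphase⟩ :=
    abs_im_logDeriv_sub_le_of_flat_root D φ hφ hρ (hflat 0) Ψ hΨf hLc hLe
  have hsub : D'.carrier ⊆ D.carrier := hD'.carrier_subset
  have hx0 : 0 < hexCriticalFugacity := hexCriticalFugacity_pos_lt_one.1
  set Q : ℝ := ‖q₀‖ with hQ
  have hQpos : 0 < Q := by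
    have h0 : 0 ≤ Q := norm_nonneg q₀
    rcases h0.lt_or_eq with h | h
    · exact h
    · exfalso; rw [← h, zero_mul] at hq₀; exact zero_ne_one hq₀
  have hQinv : d ^ ((5 : ℝ) / 8) = Q⁻¹ := eq_inv_of_mul_eq_one_right hq₀
  rw [hQinv]
  set qf : ℂ → ℂ := fun z => exp ((5 / 8 : ℂ) * ((L' z - L'b) - (L z - Lb))) with hqf
  have hqc : ContinuousOn qf D'.carrier :=
    (continuousOn_const.mul ((hL'c.sub continuousOn_const).sub
      ((hLc.mono hsub).sub continuousOn_const))).cexp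
  refine tendsto_of_eventually_between fun ε hε => ?_
  obtain ⟨η, hη0, hη4, hηQ, hlo, hhi⟩ : ∃ η : ℝ, 0 < η ∧ η ≤ 1 / 4 ∧ 4 * η ≤ Q ∧
      Q⁻¹ - ε < (1 - η) ^ 2 / (Q + 2 * η) ∧ (1 + η) ^ 2 / (Q - 2 * η) < Q⁻¹ + ε := by
    have hclo : ContinuousAt (fun η : ℝ => (1 - η) ^ 2 / (Q + 2 * η)) 0 := by
      refine ((continuousAt_const.sub continuousAt_id).pow 2).div
        (continuousAt_const.add (continuousAt_const.mul continuousAt_id)) ?_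
      simp [hQpos.ne']
    have hchi : ContinuousAt (fun η : ℝ => (1 + η) ^ 2 / (Q - 2 * η)) 0 := by
      refine ((continuousAt_const.add continuousAt_id).pow 2).div
        (continuousAt_const.sub (continuousAt_const.mul continuousAt_id)) ?_
      simp [hQpos.ne']
    have hQi : 0 < Q⁻¹ := inv_pos.2 hQpos
    have h1 : ∀ᶠ η in 𝓝 (0 : ℝ), Q⁻¹ - ε < (1 - η) ^ 2 / (Q + 2 * η) :=
      hclo.tendsto.eventually (Ioi_mem_nhds (by norm_num; linarith))
    have h2 : ∀ᶠ η in 𝓝 (0 : ℝ), (1 + η) ^ 2 / (Q - 2 * η) < Q⁻¹ + ε :=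
      hchi.tendsto.eventually (Iio_mem_nhds (by norm_num; linarith))
    have h3 : ∀ᶠ η in 𝓝 (0 : ℝ), η ≤ 1 / 4 := Iic_mem_nhds (by norm_num)
    have h4 : ∀ᶠ η in 𝓝 (0 : ℝ), η ≤ Q / 4 := Iic_mem_nhds (by positivity)
    have h5 : ∀ᶠ η in 𝓝[>] (0 : ℝ), (Q⁻¹ - ε < (1 - η) ^ 2 / (Q + 2 * η) ∧
        ((1 + η) ^ 2 / (Q - 2 * η) < Q⁻¹ + ε ∧ (η ≤ 1 / 4 ∧ η ≤ Q / 4))) ∧ 0 < η :=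
      ((h1.and (h2.and (h3.and h4))).filter_mono nhdsWithin_le_nhds).and self_mem_nhdsWithin
    obtain ⟨η, ⟨h1η, h2η, h3η, h4η⟩, hη0⟩ := h5.exists
    exact ⟨η, hη0, h3η, by linarith, h1η, h2η⟩
  have hadmRD : ∀ᶠ δ : ℝ in 𝓝[>] 0,
      hexDomainSimplyConnected (Λ δ) ∧ hexDomainSimplyConnected (Λ' δ) ∧ Λ' δ ⊆ Λ δ ∧
      a δ ∈ hexDomainBoundary (Λ δ) ∧ a δ ∈ hexDomainBoundary (Λ' δ) ∧
      (∀ v ∈ Λ δ, (δ : ℂ) * hexCenter v ∈ D.carrier) ∧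
      (∀ v : HexVertex, (δ : ℂ) * hexCenter v ∈ ball (D.pt 0) ρ → (v ∈ Λ δ ↔ m 0 δ ≤ v.1 1)) ∧
      (∀ v : HexVertex, (δ : ℂ) * hexCenter v ∈ ball (D.pt 0) ρ → (v ∈ Λ' δ ↔ v ∈ Λ δ)) := by
    filter_upwards [hadm] with δ h
    obtain ⟨h1, h2, h3, -, -, h6, -, h8, -, -, h11, -, h13⟩ := h
    exact ⟨h2, h3, h1, h6, h8, h11, fun v hv => (h13 0 v hv).1,
      fun v hv => (h13 0 v hv).2.trans (h13 0 v hv).1.symm⟩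
  obtain ⟨r₀, hr₀, hRD'⟩ := hRD D ρ Λ Λ' (m 0) a hρ (hflat 0) hadmRD ha η hη0
  obtain ⟨rq, hrq, hrqB⟩ : ∃ rq > 0, ∀ z ∈ ball (D.pt 0) rq, z ∈ D'.carrier → dist (qf z) q₀ < η := by
    have hev := Metric.tendsto_nhds.1 hqlim η hη0
    rw [eventually_nhdsWithin_iff, Metric.eventually_nhds_iff_ball] at hev
    exact hev
  set r : ℝ := min (min r₀ r₁) (min rq ρ₁) / 2 with hrdef
  have hmin : 0 < min (min r₀ r₁) (min rq ρ₁) := lt_min (lt_min hr₀ hr₁) (lt_min hrq hρ₁)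
  have hr : 0 < r := by rw [hrdef]; exact half_pos hmin
  have hrle : 2 * r ≤ min (min r₀ r₁) (min rq ρ₁) := by rw [hrdef]; linarith
  have hm1 : min (min r₀ r₁) (min rq ρ₁) ≤ r₀ := (min_le_left _ _).trans (min_le_left _ _)
  have hm2 : min (min r₀ r₁) (min rq ρ₁) ≤ r₁ := (min_le_left _ _).trans (min_le_right _ _)
  have hm3 : min (min r₀ r₁) (min rq ρ₁) ≤ rq := (min_le_right _ _).trans (min_le_left _ _)
  have hm4 : min (min r₀ r₁) (min rq ρ₁) ≤ ρ₁ := (min_le_right _ _).trans (min_le_right _ _)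
  have hr_r₀ : r < r₀ := by linarith
  have hr_r₁ : r < r₁ := by linarith
  have hr_rq : 5 * r / 4 < rq := by linarith
  have hr_ρ₁ : 5 * r / 4 < ρ₁ := by linarith
  obtain ⟨ψ, hψc, hψs, hψ0, hψne, hψsupp, hS⟩ := hRD' r hr hr_r₀
  set B : Set ℂ := ball (D.pt 0 + (r : ℂ) * I) (r / 4) with hBdef
  have hBfacts : ∀ z ∈ B, z ∈ D.carrier ∧ z ∈ D'.carrier ∧
      |(L z).im - (L (D.pt 0 + (r : ℂ) * I)).im| ≤ 3 / 2 ∧ ‖qf z - q₀‖ ≤ η := by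
    intro z hz
    obtain ⟨hzD, hph⟩ := hphase r hr hr_r₁ z hz
    have hw : z - D.pt 0 ∈ ball ((r : ℂ) * I) (r / 4) := by
      rw [mem_ball, dist_eq_norm] at hz ⊢
      rwa [sub_sub]
    obtain ⟨hwim, hwnorm, -, -⟩ := ball_I_mul_geometry hr hw
    have hzball : z ∈ ball (D.pt 0) ρ₁ := by
      rw [mem_ball, dist_eq_norm]; linarith
    have hzD' : z ∈ D'.carrier := by
      have : z ∈ {z : ℂ | (D.pt 0).im < z.im} ∩ ball (D.pt 0) ρ₁ := by
        refine ⟨?_, hzball⟩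
        show (D.pt 0).im < z.im
        rw [sub_im] at hwim; linarith
      rw [← hflat0'] at this
      exact this.1
    have hzrq : z ∈ ball (D.pt 0) rq := by
      rw [mem_ball, dist_eq_norm]; linarith
    have hzq : dist (qf z) q₀ < η := hrqB z hzrq hzD'
    rw [dist_eq_norm] at hzq
    exact ⟨hzD, hzD', hph, hzq.le⟩
  obtain ⟨hI0, hIlow, hIup⟩ := norm_integral_bounds D'.isOpen (hLc.mono hsub) Lb hqc hη0.le
    (fun z hz => (hBfacts z hz).2.1) (fun z hz => (hBfacts z hz).2.2.2)
    (fun z hz => (hBfacts z hz).2.2.1) hψc hψs hψ0 hψne hψsupp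
  set I₁ : ℂ := ∫ z, (ψ z : ℂ) * exp ((5 / 8 : ℂ) * (L z - Lb)) with hI₁
  set I₂ : ℂ := ∫ z, (ψ z : ℂ) * (exp ((5 / 8 : ℂ) * (L z - Lb)) * qf z) with hI₂
  have hI₂eq : I₂ = ∫ z, (ψ z : ℂ) * exp ((5 / 8 : ℂ) * (L' z - L'b)) := by
    rw [hI₂]
    congr 1
    funext z
    rw [hqf]
    simp only
    rw [← Complex.exp_add]
    congr 2
    ring
  have hQ2 : 0 < Q - 2 * η := by linarith
  have hI₁pos : 0 < ‖I₁‖ := norm_pos_iff.2 hI0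
  have hI₂pos : 0 < ‖I₂‖ := lt_of_lt_of_le (mul_pos hQ2 hI₁pos) hIlow
  have hI₂0 : I₂ ≠ 0 := norm_pos_iff.1 hI₂pos
  -- the ratio `R = |I₁|/|I₂|` and its bounds
  set R : ℝ := ‖I₁‖ / ‖I₂‖ with hR
  have hRpos : 0 < R := div_pos hI₁pos hI₂pos
  have hRlo : 1 / (Q + 2 * η) ≤ R := by
    rw [hR, div_le_div_iff₀ (by linarith) hI₂pos, one_mul, mul_comm]
    exact hIup
  have hRhi : R ≤ 1 / (Q - 2 * η) := by
    rw [hR, div_le_div_iff₀ hI₂pos hQ2, one_mul]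
    linarith
  set ψc : ℂ → ℂ := fun z => (ψ z : ℂ) with hψcdef
  have hψcc : Continuous ψc := continuous_ofReal.comp hψc
  have hψcs : HasCompactSupport ψc := by
    rw [HasCompactSupport, hψcdef, tsupport_ofReal_comp]; exact hψs
  have hψcB : tsupport ψc ⊆ B := by rw [hψcdef, tsupport_ofReal_comp]; exact hψsupp
  have hψcD : tsupport ψc ⊆ D.carrier := fun z hz => (hBfacts z (hψcB hz)).1
  have hψcD' : tsupport ψc ⊆ D'.carrier := fun z hz => (hBfacts z (hψcB hz)).2.1
  -- instance 1 of the observable limit: `(D, Λ)`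
  have hev1 : ∀ᶠ δ : ℝ in 𝓝[>] 0, hexDomainSimplyConnected (Λ δ) ∧
      a δ ∈ hexDomainBoundary (Λ δ) ∧ b δ ∈ hexDomainBoundary (Λ δ) ∧
      Nonempty (HexMidEdgeSAW (Λ δ) (a δ) (b δ)) ∧
      (hexGraph.induce (↑(Λ δ) : Set HexVertex)).Preconnected ∧
      (∀ v ∈ Λ δ, (δ : ℂ) * hexCenter v ∈ D.carrier) ∧
      (∀ i : Fin 2, ∀ v : HexVertex, (δ : ℂ) * hexCenter v ∈ ball (D.pt i) ρ →
        (v ∈ Λ δ ↔ m i δ ≤ v.1 1)) := by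
    filter_upwards [hadm] with δ h
    obtain ⟨h1, h2, -, h4, -, h6, h7, -, -, h10, h11, -, h13⟩ := h
    exact ⟨h2, h6, h7, nonempty_hexMidEdgeSAW_of_subset h1 h10, h4, h11,
      fun i v hv => (h13 i v hv).1⟩
  have T₁ : Tendsto (fun δ : ℝ => (δ : ℂ) ^ 2 * (∑ᶠ e ∈ hexDomainMidEdges (Λ δ),
      ψc ((δ : ℂ) * hexMidpoint e) *
        hexParafermionicObservable (Λ δ) (a δ) hexCriticalFugacity (5 / 8) e) /
      hexParafermionicObservable (Λ δ) (a δ) hexCriticalFugacity (5 / 8) (b δ)) (𝓝[>] 0)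
      (𝓝 (c * I₁)) :=
    H D ρ Λ m a b Ψ L Lb ψc hρ hflat hev1 hK ha hb hΨinf hΨb hLc hLe hLb hψcc hψcs hψcD
  -- instance 2 of the observable limit: `(D', Λ')`
  have hpt0 : D'.pt 0 = D.pt 0 := hD'.pt_zero_eq
  have hpt1 : D'.pt 1 = D.pt 1 := hD'.pt_one_eq
  have hflatD' : ∀ i : Fin 2, D'.carrier ∩ ball (D'.pt i) ρ₁ =
      {z : ℂ | (D'.pt i).im < z.im} ∩ ball (D'.pt i) ρ₁ := by
    refine Fin.forall_fin_two.2 ⟨?_, ?_⟩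
    · rw [hpt0]; exact hflat0'
    · rw [hpt1]; exact hflat1'
  have hev2 : ∀ᶠ δ : ℝ in 𝓝[>] 0, hexDomainSimplyConnected (Λ' δ) ∧
      a δ ∈ hexDomainBoundary (Λ' δ) ∧ b δ ∈ hexDomainBoundary (Λ' δ) ∧
      Nonempty (HexMidEdgeSAW (Λ' δ) (a δ) (b δ)) ∧
      (hexGraph.induce (↑(Λ' δ) : Set HexVertex)).Preconnected ∧
      (∀ v ∈ Λ' δ, (δ : ℂ) * hexCenter v ∈ D'.carrier) ∧
      (∀ i : Fin 2, ∀ v : HexVertex, (δ : ℂ) * hexCenter v ∈ ball (D'.pt i) ρ₁ →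
        (v ∈ Λ' δ ↔ m i δ ≤ v.1 1)) := by
    filter_upwards [hadm] with δ h
    obtain ⟨-, -, h3, -, h5, -, -, h8, h9, h10, -, h12, h13⟩ := h
    refine ⟨h3, h8, h9, h10, h5, h12, fun i v hv => (h13 i v ?_).2⟩
    have hball : ball (D'.pt i) ρ₁ ⊆ ball (D.pt i) ρ := by
      revert i
      refine Fin.forall_fin_two.2 ⟨?_, ?_⟩ <;> intro hv
      · rw [hpt0]; exact ball_subset_ball hρ₁ρ
      · rw [hpt1]; exact ball_subset_ball hρ₁ρ
    exact hball hv
  have ha' : Tendsto (fun δ : ℝ => (δ : ℂ) * hexMidpoint (a δ)) (𝓝[>] 0) (𝓝 (D'.pt 0)) := by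
    rw [hpt0]; exact ha
  have hb' : Tendsto (fun δ : ℝ => (δ : ℂ) * hexMidpoint (b δ)) (𝓝[>] 0) (𝓝 (D'.pt 1)) := by
    rw [hpt1]; exact hb
  have hΨ'inf' : Tendsto (fun z => ‖Ψ' z‖) (𝓝[D'.carrier] (D'.pt 0)) atTop := by
    rw [hpt0]; exact hΨ'inf
  have hΨ'b' : Ψ'.HasBoundaryValue (D'.pt 1) 0 := by rw [hpt1]; exact hΨ'b
  have hL'b' : Tendsto L' (𝓝[D'.carrier] (D'.pt 1)) (𝓝 L'b) := by rw [hpt1]; exact hL'b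
  have T₂ : Tendsto (fun δ : ℝ => (δ : ℂ) ^ 2 * (∑ᶠ e ∈ hexDomainMidEdges (Λ' δ),
      ψc ((δ : ℂ) * hexMidpoint e) *
        hexParafermionicObservable (Λ' δ) (a δ) hexCriticalFugacity (5 / 8) e) /
      hexParafermionicObservable (Λ' δ) (a δ) hexCriticalFugacity (5 / 8) (b δ)) (𝓝[>] 0)
      (𝓝 (c * I₂)) := by
    rw [hI₂eq]
    exact H D' ρ₁ Λ' m a b Ψ' L' L'b ψc hρ₁ hflatD' hev2 hK' ha' hb' hΨ'inf' hΨ'b' hL'c hL'e hL'b'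
      hψcc hψcs hψcD'
  set FΛ : ℝ → Sym2 HexVertex → ℂ := fun δ e =>
    hexParafermionicObservable (Λ δ) (a δ) hexCriticalFugacity (5 / 8) e with hFΛ
  set FΛ' : ℝ → Sym2 HexVertex → ℂ := fun δ e =>
    hexParafermionicObservable (Λ' δ) (a δ) hexCriticalFugacity (5 / 8) e with hFΛ'
  set S : ℝ → ℂ := fun δ => ∑ᶠ e ∈ hexDomainMidEdges (Λ δ),
    ψc ((δ : ℂ) * hexMidpoint e) * FΛ δ e with hSdef
  set S' : ℝ → ℂ := fun δ => ∑ᶠ e ∈ hexDomainMidEdges (Λ' δ),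
    ψc ((δ : ℂ) * hexMidpoint e) * FΛ' δ e with hS'def
  set T : ℝ → ℂ := fun δ => (δ : ℂ) ^ 2 * S δ / FΛ δ (b δ) with hTdef
  set T' : ℝ → ℂ := fun δ => (δ : ℂ) ^ 2 * S' δ / FΛ' δ (b δ) with hT'def
  have hT₁ : Tendsto T (𝓝[>] 0) (𝓝 (c * I₁)) := T₁
  have hT₂ : Tendsto T' (𝓝[>] 0) (𝓝 (c * I₂)) := T₂
  have hcI₁ : c * I₁ ≠ 0 := mul_ne_zero hc0 hI0
  have hcI₂ : c * I₂ ≠ 0 := mul_ne_zero hc0 hI₂0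
  have hRlim : Tendsto (fun δ => ‖T δ‖ / ‖T' δ‖) (𝓝[>] 0) (𝓝 R) := by
    have h := (hT₁.norm).div (hT₂.norm) (norm_ne_zero_iff.2 hcI₂)
    have heq : ‖c * I₁‖ / ‖c * I₂‖ = R := by
      rw [norm_mul, norm_mul, hR, mul_div_mul_left _ _ (norm_ne_zero_iff.2 hc0)]
    rwa [heq] at h
  have hevR : ∀ᶠ δ : ℝ in 𝓝[>] 0, |‖T δ‖ / ‖T' δ‖ - R| < η * R := by
    filter_upwards [Metric.tendsto_nhds.1 hRlim _ (mul_pos hη0 hRpos)] with δ h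
    rwa [Real.dist_eq] at h
  have hevT0 : ∀ᶠ δ : ℝ in 𝓝[>] 0, T δ ≠ 0 := hT₁.eventually_ne hcI₁
  have hevT'0 : ∀ᶠ δ : ℝ in 𝓝[>] 0, T' δ ≠ 0 := hT₂.eventually_ne hcI₂
  refine ⟨(1 - η) ^ 2 / (Q + 2 * η), (1 + η) ^ 2 / (Q - 2 * η), hlo, hhi, ?_⟩
  filter_upwards [hadm, hS, hevR, hevT0, hevT'0, self_mem_nhdsWithin] with δ hA hSδ hRδ hT0 hT'0 hδ
  have hδ0 : (0 : ℝ) < δ := hδ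
  obtain ⟨hΛ'Λ, hscΛ, hscΛ', -, -, haΛ, hbΛ, haΛ', hbΛ', hne', -, -, -⟩ := hA
  have hneΛ : Nonempty (HexMidEdgeSAW (Λ δ) (a δ) (b δ)) := nonempty_hexMidEdgeSAW_of_subset hΛ'Λ hne'
  have hZ : (∑ γ : HexMidEdgeSAW (Λ δ) (a δ) (b δ), hexCriticalFugacity ^ γ.length) = ‖FΛ δ (b δ)‖ :=
    (norm_observable_eq_mass_of_mem_boundary hscΛ haΛ hbΛ hx0.le _).symm
  have hZ' : (∑ γ : HexMidEdgeSAW (Λ' δ) (a δ) (b δ), hexCriticalFugacity ^ γ.length) =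
      ‖FΛ' δ (b δ)‖ :=
    (norm_observable_eq_mass_of_mem_boundary hscΛ' haΛ' hbΛ' hx0.le _).symm
  have hFb : FΛ δ (b δ) ≠ 0 := observable_ne_zero_of_mem_boundary hscΛ haΛ hbΛ hneΛ hx0 _
  have hF'b : FΛ' δ (b δ) ≠ 0 := observable_ne_zero_of_mem_boundary hscΛ' haΛ' hbΛ' hne' hx0 _
  have hδ2 : ((δ : ℂ)) ^ 2 ≠ 0 := pow_ne_zero 2 (by exact_mod_cast hδ0.ne')
  have hS0 : S δ ≠ 0 := by
    intro h
    apply hT0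
    show (δ : ℂ) ^ 2 * S δ / FΛ δ (b δ) = 0
    rw [h, mul_zero, zero_div]
  have hSpos : 0 < ‖S δ‖ := norm_pos_iff.2 hS0
  -- `|F(b)| = δ² |S| / |T|`
  have hnF : ‖FΛ δ (b δ)‖ = δ ^ 2 * ‖S δ‖ / ‖T δ‖ :=
    stub_avoidanceCocycle_normIdentity _ _ _ δ hδ0.le hFb hT0 rfl
  have hnF' : ‖FΛ' δ (b δ)‖ = δ ^ 2 * ‖S' δ‖ / ‖T' δ‖ :=
    stub_avoidanceCocycle_normIdentity _ _ _ δ hδ0.le hF'b hT'0 rfl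
  -- the ratio
  have hTpos : 0 < ‖T δ‖ := norm_pos_iff.2 hT0
  have hT'pos : 0 < ‖T' δ‖ := norm_pos_iff.2 hT'0
  have hratio : (∑ γ : HexMidEdgeSAW (Λ' δ) (a δ) (b δ), hexCriticalFugacity ^ γ.length) /
      (∑ γ : HexMidEdgeSAW (Λ δ) (a δ) (b δ), hexCriticalFugacity ^ γ.length) =
      (‖S' δ‖ / ‖S δ‖) * (‖T δ‖ / ‖T' δ‖) := by
    rw [hZ, hZ', hnF, hnF']
    field_simp
  rw [hratio]
  -- `|S'|/|S| ∈ [1 - η, 1 + η]`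
  have hS1 : 1 - η ≤ ‖S' δ‖ / ‖S δ‖ ∧ ‖S' δ‖ / ‖S δ‖ ≤ 1 + η := by
    have h1 : |‖S' δ‖ - ‖S δ‖| ≤ η * ‖S δ‖ := (abs_norm_sub_norm_le _ _).trans hSδ
    obtain ⟨h2, h3⟩ := abs_le.1 h1
    constructor
    · rw [le_div_iff₀ hSpos]; linarith
    · rw [div_le_iff₀ hSpos]; linarith
  -- `|T|/|T'| ∈ [R(1 - η), R(1 + η)]`
  obtain ⟨hR1, hR2⟩ := abs_lt.1 hRδ
  obtain ⟨hs1, hs2⟩ := hS1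
  have hη1 : 0 ≤ 1 - η := by linarith
  have ht1 : (1 - η) * R ≤ ‖T δ‖ / ‖T' δ‖ := by linarith
  have ht2 : ‖T δ‖ / ‖T' δ‖ ≤ (1 + η) * R := by linarith
  have htpos : 0 ≤ ‖T δ‖ / ‖T' δ‖ := div_nonneg (norm_nonneg _) (norm_nonneg _)
  constructor
  · have h1 : (1 - η) ^ 2 / (Q + 2 * η) ≤ (1 - η) * ((1 - η) * R) := by
      calc (1 - η) ^ 2 / (Q + 2 * η) = (1 - η) * (1 - η) * (1 / (Q + 2 * η)) := by ring
        _ ≤ (1 - η) * (1 - η) * R := mul_le_mul_of_nonneg_left hRlo (mul_nonneg hη1 hη1)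
        _ = (1 - η) * ((1 - η) * R) := by ring
    have h2 : (1 - η) * ((1 - η) * R) ≤ ‖S' δ‖ / ‖S δ‖ * (‖T δ‖ / ‖T' δ‖) :=
      mul_le_mul hs1 ht1 (mul_nonneg hη1 hRpos.le) (hη1.trans hs1)
    exact h1.trans h2
  · have h1 : ‖S' δ‖ / ‖S δ‖ * (‖T δ‖ / ‖T' δ‖) ≤ (1 + η) * ((1 + η) * R) :=
      mul_le_mul hs2 ht2 htpos (by linarith)
    have h2 : (1 + η) * ((1 + η) * R) ≤ (1 + η) ^ 2 / (Q - 2 * η) := by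
      calc (1 + η) * ((1 + η) * R) = (1 + η) * (1 + η) * R := by ring
        _ ≤ (1 + η) * (1 + η) * (1 / (Q - 2 * η)) :=
            mul_le_mul_of_nonneg_left hRhi (by positivity)
        _ = (1 + η) ^ 2 / (Q - 2 * η) := by ring
    exact h1.trans h2


end Assembly

end Summit.CriticalPhenomena.SAWScalingLimit.Theorems.HexConjecture.RootLocality.Cocycle

end
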